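import Summits.Ventures.HodgeRepro2.A2HardLefschetzTwelve
import Summits.Ventures.HodgeRepro2.A2WeilProjectionPeriod

/-!
# A2 annex — paragraph (A9) in the twelve-plane model: the Lieberman class `y'' = (L^{|ι|−k})^{-1} z` and the Pontryagin class `y = z ⋆ θ^k` have PROPORTIONAL Weil projections, hence the same non-vanishing criterion

Cell pub-hodge-repro2, seat p6 (Tier-4 sub-claim A2). Paragraph (A9) of route/T4-A2-p6.md ends:
«Both constructions give an element of `W_F(B)` with the same non-vanishing criterion» — the
Pontryagin class `y = z ⋆ θ^4` of Theorem A ((S3), rows 92 / 97 / 99) and the Lieberman class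
`y'' = (L^8)^{-1}(z)` of (S6) (row 75 as data; `A2HardLefschetzMain` / `A2HardLefschetzTwelve` as
theorems of the model). This file makes the sentence a kernel identity, for every number of planes
`|ι|`, every `k ≤ |ι|`, every `θ = Σ_p c_p E_p` with all `c_p ≠ 0`, and every `z ∈ ⋀^{2|ι|−k}`:

* `integral_lefschetzInv_mul_theta_pow_mul` — (A9)'s pairing identity `⟨y'', θ^{|ι|−k} ∪ w⟩ = ∫_B z ∧ w`;
* `exists_sign_integral_mul_aBasis_compl`, `exists_sign_repr_weilIndex` — row 90's / row 94's sign
  `± 1` (Lemma A5.6 in coordinates) is UNIFORM in the class: one sign per index, for all `y`;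
* `integral_lefschetzInv_mul_ET_mul_weil` — `(|ι|−k)!·c_{I_σ} · ∫_B y'' ∧ E_{I_σ} ∧ w_σ = ∫_B z ∧ w_σ`
  (Lemma A5.4 + the pairing identity);
* **`weilProjModel_pontryagin_eq_smul`** — `p_W(z ⋆ θ^k) = κ • p_W(y'')` with the EXPLICIT constant
  `κ = (|ι|−k)!·k!·(∏_p c_p)·vol` (= row 92's `weilConstant`, independent of the Weil datum);
* **`weilProjModel_lefschetzInv_ne_zero_iff`** — `p_W(y'') ≠ 0 ⇔ ∃ σ, ∫_B z ∧ w_σ ≠ 0` (the criterion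
  of row 97 for `y`, now for `y''`), and `weilProjModel_lefschetzInv_ne_zero_iff_pontryagin` —
  `p_W(y'') ≠ 0 ⇔ p_W(y) ≠ 0`;
* the twelve-plane numbers (`|ι| = 12`, `k = 4`, `z ∈ ⋀^{20}`, `y'' = yPP`): `weilProjModel_yPP_*`.

Nothing about varieties is asserted; the identification `∫_B z ∧ w_σ = ∫_S f^*w_σ` is A4.1.1 (ii) of
the prose, and the algebraicity of `y''` (Lieberman / Kleiman, E38) stays prose.
-/

namespace Summit.Ventures.HodgeRepro2.A2LiebermanModel

open WeilPlanes WeilIntegral WeilDetect WeilCoproduct A2ModelDuality A2WeilProjection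
  A2WeilProjectionPeriod A2PontryaginModel A2HardLefschetzMain

variable {ι : Type*} [DecidableEq ι] [Fintype ι]

/-- `θ` is central (each `E_p` is). -/
theorem commute_theta (c : ι → ℂ) (x : A ι) : Commute (theta c) x := by
  unfold theta
  exact Commute.sum_left _ _ _ fun p _ => (commute_E p x).smul_left (c p)

/-- Powers of `θ` are central. -/
theorem commute_theta_pow (c : ι → ℂ) (r : ℕ) (x : A ι) : Commute (theta c ^ r) x :=
  (commute_theta c x).pow_left r

/-- (A9)'s PAIRING IDENTITY: `⟨y'', θ^{|ι|−k} ∪ w⟩ = ∫_B z ∧ w` for the Lieberman class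
`y'' = (L^{|ι|−k})^{-1} z`. -/
theorem integral_lefschetzInv_mul_theta_pow_mul (c : ι → ℂ) (hc : ∀ p, c p ≠ 0) {k : ℕ}
    (hk : k ≤ Fintype.card ι) {z : A ι} (hz : z ∈ grading ι (2 * Fintype.card ι - k)) (w : A ι) :
    integral (lefschetzInv c hc hk hz * (theta c ^ (Fintype.card ι - k) * w)) = integral (z * w) := by
  rw [← mul_assoc, ← (commute_theta_pow c _ _).eq, theta_pow_mul_lefschetzInv]

/-- Row 90's complementary-coordinate sign is UNIFORM: for each index `s` there is ONE
`ε = ± 1` with `∫_B x ∧ e_{sᶜ} = ε · (the s-coordinate of x)` for EVERY `x`. -/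
theorem exists_sign_integral_mul_aBasis_compl (s : Finset (Fin (Fintype.card (Gen ι)))) :
    ∃ ε : ℂ, (ε = 1 ∨ ε = -1) ∧ ∀ x : A ι, integral (x * aBasis sᶜ) = ε * aBasis.repr x s := by
  obtain ⟨ε, hε, h⟩ := integral_aBasis_mul_aBasis_compl (ι := ι) s
  refine ⟨ε, hε, fun x => ?_⟩
  conv_lhs => rw [← aBasis.sum_repr x]
  rw [Finset.sum_mul, map_sum, Finset.sum_eq_single s]
  · rw [smul_mul_assoc, map_smul, h, smul_eq_mul, mul_comm]
  · intro t _ hts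
    rw [smul_mul_assoc, map_smul, integral_aBasis_mul_aBasis_of_ne t sᶜ
      (fun h' => hts (compl_inj_iff.mp h'.symm)), smul_zero]
  · intro hs
    exact absurd (Finset.mem_univ s) hs

/-- Row 94's Lemma A5.6 with a UNIFORM sign: for each Weil datum `(P₀, s)` there is ONE `ε = ± 1`
with `(the w_{P₀,s}-coordinate of y) = ε · ∫_B y ∧ E_{univ ∖ P₀} ∧ w_{P₀,!s}` for EVERY `y`. -/
theorem exists_sign_repr_weilIndex (P₀ : Finset ι) (s : Bool) :
    ∃ ε : ℂ, (ε = 1 ∨ ε = -1) ∧ ∀ y : A ι,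
      aBasis.repr y (weilIndex P₀ s) = ε * integral (y * (ET (Finset.univ \ P₀) * weil P₀ !s)) := by
  obtain ⟨ε₁, hε₁, h₁⟩ := aBasis_compl_weilIndex (ι := ι) P₀ s
  obtain ⟨ε₂, hε₂, h₂⟩ := exists_sign_integral_mul_aBasis_compl (ι := ι) (weilIndex P₀ s)
  have hsq : ε₂ * ε₂ = 1 := by rcases hε₂ with rfl | rfl <;> norm_num
  refine ⟨ε₂ * ε₁, ?_, fun y => ?_⟩
  · rcases hε₁ with rfl | rfl <;> rcases hε₂ with rfl | rfl <;> norm_num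
  · have := h₂ y
    rw [h₁, mul_smul_comm, map_smul, smul_eq_mul] at this
    calc aBasis.repr y (weilIndex P₀ s)
        = ε₂ * (ε₂ * aBasis.repr y (weilIndex P₀ s)) := by rw [← mul_assoc, hsq, one_mul]
      _ = ε₂ * ε₁ * integral (y * (ET (Finset.univ \ P₀) * weil P₀ !s)) := by rw [← this]; ring

omit [Fintype ι] in
/-- `E_p ∧ w_{P₀,s} = 0` for `p ∈ P₀` (the plane `p` is already used by `w_{P₀,s}`). -/
theorem E_mul_weil {P₀ : Finset ι} {p : ι} (hp : p ∈ P₀) (s : Bool) : E p * weil P₀ s = 0 :=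
  E_mul_mono_of_mem (mem_weilList.mpr ⟨hp, rfl⟩)

/-- `|univ ∖ P₀| = |ι| − |P₀|`. -/
theorem card_univ_sdiff_eq (P₀ : Finset ι) {k : ℕ} (hP : P₀.card = k) :
    (Finset.univ \ P₀).card = Fintype.card ι - k := by
  rw [Finset.card_univ_sdiff, hP]

/-- THE LIEBERMAN CLASS AGAINST `E_{I_σ} ∧ w_σ` (Lemma A5.4 + the pairing identity): for `|P₀| = k`,
`(|ι|−k)! · c_{univ ∖ P₀} · ∫_B y'' ∧ E_{univ ∖ P₀} ∧ w_{P₀,s} = ∫_B z ∧ w_{P₀,s}`. -/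
theorem integral_lefschetzInv_mul_ET_mul_weil (c : ι → ℂ) (hc : ∀ p, c p ≠ 0) {k : ℕ}
    (hk : k ≤ Fintype.card ι) {z : A ι} (hz : z ∈ grading ι (2 * Fintype.card ι - k))
    (P₀ : Finset ι) (hP : P₀.card = k) (s : Bool) :
    (((Fintype.card ι - k).factorial : ℂ) * ∏ p ∈ Finset.univ \ P₀, c p) *
      integral (lefschetzInv c hc hk hz * (ET (Finset.univ \ P₀) * weil P₀ s)) =
      integral (z * weil P₀ s) := by
  have h := theta_pow_card_mul c P₀ (weil P₀ s) fun p hp => E_mul_weil hp s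
  rw [card_univ_sdiff_eq P₀ hP] at h
  rw [← integral_lefschetzInv_mul_theta_pow_mul c hc hk hz (weil P₀ s), h, mul_smul_comm, map_smul,
    smul_eq_mul]

/-- Row 92's constant `weilConstant P₀ c` depends on the datum only through `|P₀| = k`:
`κ = (|ι|−k)! · k! · (∏_p c_p) · vol`. -/
theorem weilConstant_eq_of_card (c : ι → ℂ) (P₀ : Finset ι) {k : ℕ} (hP : P₀.card = k) :
    weilConstant P₀ c =
      (((Fintype.card ι - k).factorial : ℂ) * (k.factorial : ℂ) * ∏ p, c p) * vol ι := by
  rw [weilConstant, card_univ_sdiff_eq P₀ hP, hP]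

/-- THE TWO CLASSES HAVE PROPORTIONAL INTEGRALS AGAINST `E_{I_σ} ∧ w_σ`:
`∫_B (z ⋆ θ^k) ∧ E_{I_σ} ∧ w_σ = weilConstant P₀ c · ∫_B y'' ∧ E_{I_σ} ∧ w_σ`. -/
theorem integral_pontryagin_eq_weilConstant_mul (c : ι → ℂ) (hc : ∀ p, c p ≠ 0) {k : ℕ}
    (hk : k ≤ Fintype.card ι) {z : A ι} (hz : z ∈ grading ι (2 * Fintype.card ι - k))
    (P₀ : Finset ι) (hP : P₀.card = k) (s : Bool) :
    integral (pontryagin z (theta c ^ k) * (ET (Finset.univ \ P₀) * weil P₀ s)) =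
      weilConstant P₀ c *
        integral (lefschetzInv c hc hk hz * (ET (Finset.univ \ P₀) * weil P₀ s)) := by
  have h1 := integral_pontryagin_mul_ET_mul_weil P₀ s c hc z
  rw [hP] at h1
  rw [h1, ← integral_lefschetzInv_mul_ET_mul_weil c hc hk hz P₀ hP s, weilConstant_eq,
    card_univ_sdiff_eq P₀ hP]
  ring

/-- THE WEIL PROJECTIONS ARE PROPORTIONAL: for a family `W` of Weil data of common size `k`,
`p_W(z ⋆ θ^k) = κ • p_W(y'')` with `κ = (|ι|−k)!·k!·(∏_p c_p)·vol` — paragraph (A9)'s «both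
constructions give an element of `W_F(B)`» as an identity of the model. -/
theorem weilProjModel_pontryagin_eq_smul (c : ι → ℂ) (hc : ∀ p, c p ≠ 0) {k : ℕ}
    (hk : k ≤ Fintype.card ι) {z : A ι} (hz : z ∈ grading ι (2 * Fintype.card ι - k))
    (W : Finset (Finset ι × Bool)) (hW : ∀ d ∈ W, d.1.card = k) :
    weilProjModel W (pontryagin z (theta c ^ k)) =
      ((((Fintype.card ι - k).factorial : ℂ) * (k.factorial : ℂ) * ∏ p, c p) * vol ι) •
        weilProjModel W (lefschetzInv c hc hk hz) := by
  unfold weilProjModel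
  rw [Finset.smul_sum]
  refine Finset.sum_congr rfl fun d hd => ?_
  rw [smul_smul]
  congr 1
  obtain ⟨ε, _, hε⟩ := exists_sign_repr_weilIndex (ι := ι) d.1 d.2
  rw [hε, hε, integral_pontryagin_eq_weilConstant_mul c hc hk hz d.1 (hW d hd) (!d.2),
    weilConstant_eq_of_card c d.1 (hW d hd)]
  ring

/-- The constant `κ` is non-zero. -/
theorem kappa_ne_zero (c : ι → ℂ) (hc : ∀ p, c p ≠ 0) (k : ℕ) :
    (((Fintype.card ι - k).factorial : ℂ) * (k.factorial : ℂ) * ∏ p, c p) * vol ι ≠ 0 := by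
  refine mul_ne_zero (mul_ne_zero (mul_ne_zero ?_ ?_) ?_) (vol_ne_zero ι)
  · exact Nat.cast_ne_zero.mpr (Nat.factorial_ne_zero _)
  · exact Nat.cast_ne_zero.mpr (Nat.factorial_ne_zero _)
  · exact Finset.prod_ne_zero_iff.mpr fun p _ => hc p

/-- `p_W(y'') = 0 ⇔ p_W(z ⋆ θ^k) = 0`. -/
theorem weilProjModel_lefschetzInv_eq_zero_iff_pontryagin (c : ι → ℂ) (hc : ∀ p, c p ≠ 0) {k : ℕ}
    (hk : k ≤ Fintype.card ι) {z : A ι} (hz : z ∈ grading ι (2 * Fintype.card ι - k))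
    (W : Finset (Finset ι × Bool)) (hW : ∀ d ∈ W, d.1.card = k) :
    weilProjModel W (lefschetzInv c hc hk hz) = 0 ↔
      weilProjModel W (pontryagin z (theta c ^ k)) = 0 := by
  rw [weilProjModel_pontryagin_eq_smul c hc hk hz W hW, smul_eq_zero]
  exact ⟨fun h => Or.inr h, fun h => h.resolve_left (kappa_ne_zero c hc k)⟩

/-- THE NON-VANISHING CRITERION FOR THE LIEBERMAN CLASS (row 97's criterion, now for `y''`): for
`W` of common size `k ≥ 1`, `p_W(y'') = 0 ⇔ every period ∫_B z ∧ w_{P₀,!s} vanishes`. -/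
theorem weilProjModel_lefschetzInv_eq_zero_iff (c : ι → ℂ) (hc : ∀ p, c p ≠ 0) {k : ℕ}
    (hk1 : 1 ≤ k) (hk : k ≤ Fintype.card ι) {z : A ι} (hz : z ∈ grading ι (2 * Fintype.card ι - k))
    (W : Finset (Finset ι × Bool)) (hW : ∀ d ∈ W, d.1.card = k) :
    weilProjModel W (lefschetzInv c hc hk hz) = 0 ↔
      ∀ d ∈ W, integral (z * weil d.1 !d.2) = 0 := by
  rw [weilProjModel_lefschetzInv_eq_zero_iff_pontryagin c hc hk hz W hW]
  exact weilProjModel_pontryagin_eq_zero_iff W k hk1 hW c hc z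

/-- `p_W(y'') ≠ 0 ⇔ ∃ σ, ∫_B z ∧ w_σ ≠ 0`. -/
theorem weilProjModel_lefschetzInv_ne_zero_iff (c : ι → ℂ) (hc : ∀ p, c p ≠ 0) {k : ℕ}
    (hk1 : 1 ≤ k) (hk : k ≤ Fintype.card ι) {z : A ι} (hz : z ∈ grading ι (2 * Fintype.card ι - k))
    (W : Finset (Finset ι × Bool)) (hW : ∀ d ∈ W, d.1.card = k) :
    weilProjModel W (lefschetzInv c hc hk hz) ≠ 0 ↔
      ∃ d ∈ W, integral (z * weil d.1 !d.2) ≠ 0 := by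
  rw [Ne, weilProjModel_lefschetzInv_eq_zero_iff_pontryagin c hc hk hz W hW]
  exact weilProjModel_pontryagin_ne_zero_iff W k hk1 hW c hc z

/-- «The same non-vanishing criterion»: `p_W(y'') ≠ 0 ⇔ p_W(y) ≠ 0`. -/
theorem weilProjModel_lefschetzInv_ne_zero_iff_pontryagin (c : ι → ℂ) (hc : ∀ p, c p ≠ 0) {k : ℕ}
    (hk : k ≤ Fintype.card ι) {z : A ι} (hz : z ∈ grading ι (2 * Fintype.card ι - k))
    (W : Finset (Finset ι × Bool)) (hW : ∀ d ∈ W, d.1.card = k) :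
    weilProjModel W (lefschetzInv c hc hk hz) ≠ 0 ↔
      weilProjModel W (pontryagin z (theta c ^ k)) ≠ 0 :=
  not_congr (weilProjModel_lefschetzInv_eq_zero_iff_pontryagin c hc hk hz W hW)

section twelve

open A2TwelvePlanes A2HardLefschetzTwelve

/-- The twelve-plane `y'' = yPP` IS the general `lefschetzInv` at `k = 4` (both are the unique
preimage of `z` under `θ^8 ∧ ·` in `⋀^4`). -/
theorem yPP_eq_lefschetzInv (c : ι₁₂ → ℂ) (hc : ∀ p, c p ≠ 0) {z : A ι₁₂}
    (hz : z ∈ grading ι₁₂ 20) :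
    yPP c hc hz = lefschetzInv c hc (k := 4) (by rw [card_twelve]; norm_num)
      (by rw [card_twelve]; exact hz) := by
  refine lefschetzInv_unique c hc _ _ (yPP_mem c hc hz) ?_
  rw [card_twelve]
  exact theta_pow_eight_mul_yPP c hc hz

/-- TWELVE PLANES: `p_W(z ⋆ θ^4) = 8!·4!·(∏_p c_p)·vol • p_W(y'')` for a family `W` of Weil data of
size 4 and `z ∈ ⋀^{20}`. -/
theorem weilProjModel_pontryagin_eq_smul_twelve (c : ι₁₂ → ℂ) (hc : ∀ p, c p ≠ 0) {z : A ι₁₂}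
    (hz : z ∈ grading ι₁₂ 20) (W : Finset (Finset ι₁₂ × Bool)) (hW : ∀ d ∈ W, d.1.card = 4) :
    weilProjModel W (pontryagin z (theta c ^ 4)) =
      ((((Nat.factorial 8 : ℕ) : ℂ) * ((Nat.factorial 4 : ℕ) : ℂ) * ∏ p, c p) * vol ι₁₂) •
        weilProjModel W (yPP c hc hz) := by
  rw [yPP_eq_lefschetzInv c hc hz,
    weilProjModel_pontryagin_eq_smul c hc (k := 4) (by rw [card_twelve]; norm_num)
      (by rw [card_twelve]; exact hz) W hW]
  congr 1

/-- TWELVE PLANES: `p_W(y'') ≠ 0 ⇔ ∃ σ, ∫_B z ∧ w_σ ≠ 0` — the non-vanishing input (N) is the same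
criterion for (A9)'s class as for Theorem A's class. -/
theorem weilProjModel_yPP_ne_zero_iff (c : ι₁₂ → ℂ) (hc : ∀ p, c p ≠ 0) {z : A ι₁₂}
    (hz : z ∈ grading ι₁₂ 20) (W : Finset (Finset ι₁₂ × Bool)) (hW : ∀ d ∈ W, d.1.card = 4) :
    weilProjModel W (yPP c hc hz) ≠ 0 ↔ ∃ d ∈ W, integral (z * weil d.1 !d.2) ≠ 0 := by
  rw [yPP_eq_lefschetzInv c hc hz]
  exact weilProjModel_lefschetzInv_ne_zero_iff c hc (by norm_num) _ _ W hW

/-- TWELVE PLANES: `p_W(y'') ≠ 0 ⇔ p_W(z ⋆ θ^4) ≠ 0`. -/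
theorem weilProjModel_yPP_ne_zero_iff_pontryagin (c : ι₁₂ → ℂ) (hc : ∀ p, c p ≠ 0) {z : A ι₁₂}
    (hz : z ∈ grading ι₁₂ 20) (W : Finset (Finset ι₁₂ × Bool)) (hW : ∀ d ∈ W, d.1.card = 4) :
    weilProjModel W (yPP c hc hz) ≠ 0 ↔ weilProjModel W (pontryagin z (theta c ^ 4)) ≠ 0 := by
  rw [yPP_eq_lefschetzInv c hc hz]
  exact weilProjModel_lefschetzInv_ne_zero_iff_pontryagin c hc _ _ W hW

end twelve

end Summit.Ventures.HodgeRepro2.A2LiebermanModel
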